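import Literature.IUT.LogVolume.LatticeAutOrbits
import Literature.IUT.LogVolume.RamificationInvariants
import HarnessLib

/-!
# Lattice automorphisms preserve ALL balls of a `p`-adic field only when it is absolutely unramified
# (Weil, *Basic Number Theory*, Ch. II §2, Th. 1–2)

Classical `ℤ_p`-lattice algebra for the abc-iut cell (the (Ind2) slot of the Dupuy–Hilado reading of [IUTchIII]
Thm. 3.11 (i) is the group of ALL lattice automorphisms of the log-shell `I_v ⊂ K_v`, Dupuy–Hilado arXiv:2004.13228
§4.9: "`ℚ_p`-vector space automorphisms which arise as `ℤ_p`-lattice isomorphisms of `I_v`"; the hull-sets of the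
real packet frame at a single field factor are the balls `λ·𝒪_{K_v} = {‖y‖ ≤ ‖λ‖}`, [IUTchIII] Rmk. 3.9.5 (i)). For a
nontrivially normed ultrametric field `K` that is a normed `ℚ_p`-algebra (so `‖p‖ = p⁻¹`), the lattice `Λ = L_b` of a
basis `b` of `K` over `ℚ_p` (tree `PadicModule.basisLattice`; every `ℤ_p`-lattice is one, e.g. `log_p(𝒪^×)` —
`exists_adaptedBasis`) and the group `Aut_{ℚ_p}(K : Λ)` (tree `latticeAut`):

* `basisLattice_subset_closedBall_of_norm_le`: `Λ ⊆ {‖y‖ ≤ ‖b_{i₀}‖}` for a basis vector `b_{i₀}` of maximal norm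
  (ultrametric inequality);
* `closedBall_subset_basisLattice_of_forall_image_closedBall`: if EVERY lattice automorphism maps every ball
  `{‖y‖ ≤ ‖t‖}` (`t ≠ 0`) onto a ball, then conversely `{‖y‖ ≤ ‖b_{i₀}‖} ⊆ Λ` — so `Λ` IS that ball: a vector
  `y = c·x₀` with `x₀` primitive (tree `exists_eq_smul_primitive`) is carried to `c·b_{i₀}` by an automorphism with
  `x₀ ↦ b_{i₀}` (tree `exists_latticeAut_map_eq`, Weil's Th. 1 "a primitive point may be taken as part of a basis"),
  and the automorphism fixes the ball;
* **`norm_le_inv_prime_of_forall_image_closedBall`**: under the same hypothesis every `x` with `‖x‖ < 1` has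
  `‖x‖ ≤ p⁻¹`, i.e. the value group of `K` meets `(p⁻¹, 1)` trivially — `K` is ABSOLUTELY UNRAMIFIED (`e = 1`):
  otherwise `v = x·b_{i₀}` is a primitive vector of `Λ` spanning a ball strictly between `p·Λ` and `Λ`, and the
  automorphism `v ↦ b_{i₀}` maps that ball onto a set containing `b_{i₀}`, hence (were it a ball) onto `Λ` itself;
* the contrapositive **`exists_latticeAut_image_closedBall_ne`**: if `p⁻¹ < ‖x‖ < 1` for some `x` (e.g. a
  uniformizer when `e ≥ 2`, `exists_norm_mem_Ioo_of_two_le_absRamificationIdx`) then SOME lattice automorphism maps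
  SOME ball onto a set that is NOT a ball.
[cite: WeilBNT1967, Ch. II §2, Th. 1] [cite: DupuyHilado2025, §4.9] No side is taken on [IUTchIII] Cor. 3.12 (the
consumer — abc-iut-c312-5's `Cor312Ind2BallsRamified` — reads this at the (Ind2) group `Real.ismDH` of a ramified place).
PROOF-ONLY file: no new definitions, no named `Prop` facts.
-/

noncomputable section

open Set Metric
open scoped Pointwise

namespace Literature.IUT.LogVolume

namespace PadicModule

variable (p : ℕ) [Fact p.Prime]
variable {K : Type*} [NontriviallyNormedField K] [NormedAlgebra ℚ_[p] K] [IsUltrametricDist K]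
variable {ι : Type*} [Fintype ι]

/-! ### The lattice lies in the ball of a longest basis vector -/

/-- **`L_b ⊆ {‖y‖ ≤ ‖b_{i₀}‖}`** when `‖b_i‖ ≤ ‖b_{i₀}‖` for all `i` (ultrametric: `‖Σ a_i b_i‖ ≤ max ‖a_i‖‖b_i‖`).
[cite: WeilBNT1967, Ch. II §2, Th. 1] -/
theorem basisLattice_subset_closedBall_of_norm_le (b : Module.Basis ι ℚ_[p] K) {i₀ : ι} (hi₀ : ∀ i, ‖b i‖ ≤ ‖b i₀‖) :
    (basisLattice p b : Set K) ⊆ closedBall 0 ‖b i₀‖ := by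
  intro w hw
  rw [SetLike.mem_coe, mem_basisLattice] at hw
  rw [mem_closedBall, dist_zero_right, ← b.sum_repr w]
  refine IsUltrametricDist.norm_sum_le_of_forall_le_of_nonneg (norm_nonneg _) fun i _ => ?_
  rw [norm_smul]
  calc ‖b.repr w i‖ * ‖b i‖ ≤ 1 * ‖b i₀‖ := mul_le_mul (hw i) (hi₀ i) (norm_nonneg _) zero_le_one
    _ = ‖b i₀‖ := one_mul _

omit [IsUltrametricDist K] [Fintype ι] in
/-- A basis vector is a primitive lattice vector: `‖(b.repr (b i)) i‖ = 1`. [cite: WeilBNT1967, Ch. II §2, Th. 1] -/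
theorem norm_repr_basis_self (b : Module.Basis ι ℚ_[p] K) (i : ι) : ‖b.repr (b i) i‖ = 1 := by
  classical
  rw [Module.Basis.repr_self, Finsupp.single_eq_same, norm_one]

omit [IsUltrametricDist K] in
/-- A lattice automorphism maps `L_b` onto itself (tree `latticeAut.image_eq`, coercions aligned). [cite: WeilBNT1967, Ch. II §2, Th. 1] -/
theorem image_basisLattice_eq_of_mem (b : Module.Basis ι ℚ_[p] K) {φ : K ≃ₗ[ℚ_[p]] K}
    (hφ : φ ∈ latticeAut ℚ_[p] (basisLattice p b).toIntSubmodule) :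
    φ '' (basisLattice p b : Set K) = basisLattice p b :=
  latticeAut.image_eq hφ

section Balls

variable (b : Module.Basis ι ℚ_[p] K)
  -- EVERY lattice automorphism maps EVERY ball `{‖y‖ ≤ ‖t‖}`, `t ≠ 0`, onto a ball
  (H : ∀ φ ∈ latticeAut ℚ_[p] (basisLattice p b).toIntSubmodule, ∀ t : K, t ≠ 0 →
    ∃ μ : K, φ '' closedBall (0 : K) ‖t‖ = closedBall 0 ‖μ‖)

include H

/-- Under the ball hypothesis a lattice automorphism maps the ball of a longest basis vector INTO itself (the image is
a ball containing `φ(L_b) = L_b ∋ b_{i₀}`, applied to `φ⁻¹`). [cite: WeilBNT1967, Ch. II §2, Th. 1] -/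
theorem image_closedBall_subset_of_forall_image_closedBall {i₀ : ι} (hi₀ : ∀ i, ‖b i‖ ≤ ‖b i₀‖)
    {φ : K ≃ₗ[ℚ_[p]] K} (hφ : φ ∈ latticeAut ℚ_[p] (basisLattice p b).toIntSubmodule) :
    φ '' closedBall (0 : K) ‖b i₀‖ ⊆ closedBall 0 ‖b i₀‖ := by
  classical
  have hb0 : b i₀ ≠ 0 := b.ne_zero i₀
  -- `φ⁻¹` maps the ball onto a ball containing `b_{i₀}`, hence containing the ball
  obtain ⟨μ, hμ⟩ := H φ⁻¹ (inv_mem hφ) (b i₀) hb0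
  have hμ' : ⇑φ.symm '' closedBall (0 : K) ‖b i₀‖ = closedBall 0 ‖μ‖ := hμ
  have hmem : b i₀ ∈ ⇑φ.symm '' closedBall (0 : K) ‖b i₀‖ := by
    have h1 : b i₀ ∈ (basisLattice p b : Set K) := basis_mem_basisLattice p b i₀
    have h2 : ⇑φ.symm '' (basisLattice p b : Set K) = basisLattice p b :=
      image_basisLattice_eq_of_mem p b (inv_mem hφ)
    rw [← h2] at h1
    obtain ⟨w, hw, hwe⟩ := h1
    exact ⟨w, basisLattice_subset_closedBall_of_norm_le p b hi₀ hw, hwe⟩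
  rw [hμ', mem_closedBall, dist_zero_right] at hmem
  have hsub : closedBall (0 : K) ‖b i₀‖ ⊆ ⇑φ.symm '' closedBall (0 : K) ‖b i₀‖ := by
    rw [hμ']
    exact closedBall_subset_closedBall hmem
  rintro _ ⟨y, hy, rfl⟩
  obtain ⟨z, hz, hzy⟩ := hsub hy
  have : φ y = z := by
    rw [← hzy]
    exact LinearEquiv.apply_symm_apply φ z
  rw [this]
  exact hz

/-- **Under the ball hypothesis the lattice IS the ball of its longest basis vector**: `{‖y‖ ≤ ‖b_{i₀}‖} ⊆ L_b`.
[cite: WeilBNT1967, Ch. II §2, Th. 1] [cite: Cassels1997, Ch. I §2, Th. I Cor. 3] -/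
theorem closedBall_subset_basisLattice_of_forall_image_closedBall {i₀ : ι} (hi₀ : ∀ i, ‖b i‖ ≤ ‖b i₀‖) :
    closedBall (0 : K) ‖b i₀‖ ⊆ (basisLattice p b : Set K) := by
  classical
  intro y hy
  by_contra hyΛ
  have hy0 : y ≠ 0 := by
    rintro rfl
    exact hyΛ (basisLattice p b).zero_mem
  obtain ⟨c, x₀, i, hc0, hx₀, hi, hyc, hle⟩ := exists_eq_smul_primitive p b hy0
  -- `y ∉ L_b`: some coordinate has norm `> 1`, so `‖c‖ > 1`
  have hc1 : 1 < ‖c‖ := by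
    by_contra h
    push Not at h
    exact hyΛ ((mem_basisLattice p b).2 fun j => (hle j).trans h)
  -- an automorphism with `x₀ ↦ b_{i₀}` maps the ball into itself, so `c • b_{i₀}` lies in the ball
  obtain ⟨φ, hφ, hφx⟩ := exists_latticeAut_map_eq p b hx₀ (basis_mem_basisLattice p b i₀) hi
    (norm_repr_basis_self p b i₀)
  have hin : φ y ∈ closedBall (0 : K) ‖b i₀‖ :=
    image_closedBall_subset_of_forall_image_closedBall p b H hi₀ hφ ⟨y, hy, rfl⟩
  rw [hyc, LinearEquiv.map_smul, hφx, mem_closedBall, dist_zero_right, norm_smul] at hin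
  have hb0 : 0 < ‖b i₀‖ := norm_pos_iff.2 (b.ne_zero i₀)
  exact absurd ((mul_le_iff_le_one_left hb0).1 hin) (not_le.2 hc1)

/-- **The ball hypothesis forces `e = 1`**: every `x` with `‖x‖ < 1` has `‖x‖ ≤ p⁻¹` (no value of `K^×` strictly between
`p⁻¹` and `1`). [cite: WeilBNT1967, Ch. II §2, Th. 2] -/
theorem norm_le_inv_prime_of_forall_image_closedBall [Nonempty ι] {x : K} (hx : ‖x‖ < 1) : ‖x‖ ≤ (p : ℝ)⁻¹ := by
  classical
  obtain ⟨i₀, -, hi₀⟩ := Finset.exists_max_image Finset.univ (fun i => ‖b i‖) Finset.univ_nonempty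
  replace hi₀ : ∀ i, ‖b i‖ ≤ ‖b i₀‖ := fun i => hi₀ i (Finset.mem_univ i)
  have hΛ : (basisLattice p b : Set K) = closedBall 0 ‖b i₀‖ :=
    Set.Subset.antisymm (basisLattice_subset_closedBall_of_norm_le p b hi₀)
      (closedBall_subset_basisLattice_of_forall_image_closedBall p b H hi₀)
  have hb0 : 0 < ‖b i₀‖ := norm_pos_iff.2 (b.ne_zero i₀)
  by_contra hpx
  push Not at hpx
  -- `v = x · b_{i₀}` is a lattice vector outside `p·L_b`, hence primitive
  set v : K := x * b i₀ with hv
  have hvn : ‖v‖ = ‖x‖ * ‖b i₀‖ := norm_mul _ _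
  have hvΛ : v ∈ basisLattice p b := by
    rw [← SetLike.mem_coe, hΛ, mem_closedBall, dist_zero_right, hvn]
    exact (mul_lt_of_lt_one_left hb0 hx).le
  have hvp : v ∉ (p : ℚ_[p]) • (basisLattice p b : Set K) := by
    rintro ⟨w, hw, hwv⟩
    have hw' : ‖w‖ ≤ ‖b i₀‖ := by
      have := (hΛ ▸ hw : w ∈ closedBall (0 : K) ‖b i₀‖)
      rwa [mem_closedBall, dist_zero_right] at this
    have h1 : ‖v‖ = ‖(p : ℚ_[p])‖ * ‖w‖ := by rw [← hwv, norm_smul]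
    rw [Padic.norm_p, hvn] at h1
    have : ‖x‖ * ‖b i₀‖ ≤ (p : ℝ)⁻¹ * ‖b i₀‖ := by
      rw [h1]; exact mul_le_mul_of_nonneg_left hw' (by positivity)
    exact absurd (le_of_mul_le_mul_right this hb0) (not_le.2 hpx)
  obtain ⟨i, hi⟩ := (primitive_iff_not_mem_p_smul p b hvΛ).2 hvp
  -- an automorphism with `v ↦ b_{i₀}`; the ball of `v` is mapped onto a ball containing `b_{i₀}` …
  obtain ⟨φ, hφ, hφv⟩ := exists_latticeAut_map_eq p b hvΛ (basis_mem_basisLattice p b i₀) hi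
    (norm_repr_basis_self p b i₀)
  have hv0 : v ≠ 0 := by
    intro h0
    rw [h0, map_zero] at hφv
    exact b.ne_zero i₀ hφv.symm
  obtain ⟨μ, hμ⟩ := H φ hφ v hv0
  have hbμ : ‖b i₀‖ ≤ ‖μ‖ := by
    have : b i₀ ∈ φ '' closedBall (0 : K) ‖v‖ := ⟨v, by simp, hφv⟩
    rw [hμ, mem_closedBall, dist_zero_right] at this
    exact this
  -- … so `φ(ball v) ⊇ ball b_{i₀} = L_b = φ(L_b) = φ(ball b_{i₀})`, whence `ball v ⊇ ball b_{i₀} ∋ b_{i₀}`: absurd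
  have hsup : φ '' closedBall (0 : K) ‖b i₀‖ ⊆ φ '' closedBall (0 : K) ‖v‖ := by
    rw [hμ, ← hΛ, image_basisLattice_eq_of_mem p b hφ, hΛ]
    exact closedBall_subset_closedBall hbμ
  have hmem : b i₀ ∈ closedBall (0 : K) ‖v‖ :=
    (Set.image_subset_image_iff φ.injective).1 hsup (by simp)
  rw [mem_closedBall, dist_zero_right, hvn] at hmem
  exact absurd hmem (not_le.2 (mul_lt_of_lt_one_left hb0 hx))

end Balls

/-- **A lattice automorphism moving a ball off the balls**: if `K` has an element of norm strictly between `p⁻¹` and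
`1` (ramification index `≥ 2`), then for every basis lattice `L_b` some `φ ∈ Aut_{ℚ_p}(K : L_b)` maps some ball
`{‖y‖ ≤ ‖t‖}`, `t ≠ 0`, onto a set that is no ball. [cite: WeilBNT1967, Ch. II §2, Th. 1] [cite: DupuyHilado2025, §4.9] -/
theorem exists_latticeAut_image_closedBall_ne [Nonempty ι] (b : Module.Basis ι ℚ_[p] K)
    (hram : ∃ x : K, (p : ℝ)⁻¹ < ‖x‖ ∧ ‖x‖ < 1) :
    ∃ φ ∈ latticeAut ℚ_[p] (basisLattice p b).toIntSubmodule, ∃ t : K, t ≠ 0 ∧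
      ∀ μ : K, φ '' closedBall (0 : K) ‖t‖ ≠ closedBall 0 ‖μ‖ := by
  obtain ⟨x, hpx, hx1⟩ := hram
  by_contra H
  push Not at H
  exact absurd (norm_le_inv_prime_of_forall_image_closedBall p b (fun φ hφ t ht => by
    obtain ⟨μ, hμ⟩ := H φ hφ t ht; exact ⟨μ, hμ⟩) hx1) (not_le.2 hpx)

/-- **Ramification index `≥ 2` supplies such an element**: a uniformizer has norm `p^{-1/e} ∈ (p⁻¹, 1)`
(tree `norm_eq_rpow_of_isUniformizer`). [cite: WeilBNT1967, Ch. II §2, Th. 2] -/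
theorem exists_norm_mem_Ioo_of_two_le_absRamificationIdx [ProperSpace K] (he : 2 ≤ absRamificationIdx p K) :
    ∃ x : K, (p : ℝ)⁻¹ < ‖x‖ ∧ ‖x‖ < 1 := by
  obtain ⟨ϖ, hϖ⟩ := Literature.NumberTheory.GaloisRepresentations.Ultrametric.exists_isUniformizer (F := K)
  refine ⟨(ϖ : K), ?_, hϖ.1⟩
  rw [norm_eq_rpow_of_isUniformizer p K hϖ, ← Real.rpow_neg_one]
  have hp1 : 1 < (p : ℝ) := by exact_mod_cast (Fact.out : p.Prime).one_lt
  refine Real.rpow_lt_rpow_of_exponent_lt hp1 ?_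
  have he' : (2 : ℝ) ≤ absRamificationIdx p K := by exact_mod_cast he
  rw [neg_lt_neg_iff, div_lt_one (by linarith)]
  linarith

end PadicModule

end Literature.IUT.LogVolume

end
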